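import Literature.Algebra.EuclideanLattices.SmoothingGaussianFourier
import Literature.Algebra.EuclideanLattices.SmoothingParameterBounds
import HarnessLib

/-!
# Micciancio–Regev 2007, proof of Thm. 5.23 (`GapCVP′ → SIS′`): the parameter estimates — proved

Topic `Algebra/EuclideanLattices` (family `pqc`); serves the decomposition of the named fact
`Literature.Computability.Cryptography.MicciancioRegev2007_gapCVP'_to_SIS'` (MR07 Thm. 5.23 proper,
`GapSVPToSIS.lean`). The NO-case analysis of the reduction (authors' version pp. 29–31) runs on four
numerical facts about the parameters `ε = 2⁻ⁿ`, `γ = 14π√n β`, `s = 2√n/(γd)`, `q ≥ 4√m n^{1.5} β`,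
`N = n³m³`, which this file PROVES exactly as printed (theorems only, no definitions):

* `MicciancioRegev2007.smoothingParameter_dual_lt` — **eq. (15)**: for a full-rank lattice `L` of
  dimension `n ≥ 1` with `λ₁(L) > γd > 0`, `η_{2⁻ⁿ}(L*) ≤ √n/λ₁(L) < √n/(γd) = s/2` (MR07 Lemma 3.2,
  tree: `smoothingParameter_two_pow_neg_le_holds`, applied to `L*` with `L** = L`); packaged forms
  `…_lt_half` (`η < s/2`) and `…_le` (`η ≤ s`, the hypothesis of Lemma 5.7 / Cor. 4.6 / Lemma 4.2–4.4).
* `MicciancioRegev2007.twelve_mul_sq_lt` — **test (c) threshold** (p. 30): with `ℓ = 2sβ`,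
  `3ℓ² = 12 s²β² = 48nβ²/(γ²d²) < 1/(2πd)²`; for `γ = 14π√n β` this is `48 < 49` (the printed constant
  `14π` is the least integer multiple of `π` making it true: `12·4/k² < 1/4 ⟺ k² > 192`).
* `MicciancioRegev2007.combine_error_le` — **first display of p. 31**: from Lemma 5.8
  (`‖x - Cz‖ ≤ n√m ‖S‖‖z‖/q`, tree: `MicciancioRegev2007.norm_combine_sub_le_sqrt`),
  `‖S‖ ≤ 8β√n η` (Cor. 5.13), `‖z‖ ≤ β` and `q ≥ 4√m n^{1.5} β`: `n√m ‖S‖‖z‖/q ≤ 2βη`, and `2βη < sβ`.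
* `MicciancioRegev2007.sqrt_div_le_infDist_of_no` and `MicciancioRegev2007.integral_cos_le_of_far` —
  **eq. (16), one sample**: on a NO instance (`dist(k t, L) > γd` for odd `k`), `√n/s = γd/2 ≤
  dist(k t, L)`, hence by Cor. 4.6 (tree: `integral_discreteGaussian_cos_le`, for the lattice `L*`
  whose dual is `L`) `Exp_{y ∼ D_{L*,s,c}}[cos(2π⟨y + ŵ, k t⟩)] ≤ (1+ε)/(1-ε)·2⁻ⁿ ≤ 2⁻ⁿ⁺¹` for `n ≥ 2`
  (`(1+ε)/(1-ε) ≤ 2` iff `ε ≤ 1/3`; p. 30: "`w = -zⱼ(ŵ + yⱼ)` … `cos(2π⟨t, w⟩) = cos(2π⟨-zⱼt, ŵ + yⱼ⟩)`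
  … `≤ (1+ε)/(1-ε) · 2⁻ⁿ ≤ 2⁻ⁿ⁺¹`").

What is NOT here: the sampling of `W` (Lemma 5.7, Hoeffding (14), Lemma 5.20, eqs. (17)–(20)) and
anything machine-level; see the census in the provefact notes of the named fact.

## References

* D. Micciancio, O. Regev, *Worst-case to average-case reductions based on Gaussian measures*,
  SIAM J. Comput. 37 (2007) 267–302; authors' version (`lit read doi:10.1137/S0097539705447360`),
  Thm. 5.23 and its proof, pp. 28–31: eq. (15) p. 29, eq. (16) and test (c) p. 30, first display p. 31.
-/

noncomputable section

open MeasureTheory Module Metric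
open scoped Real InnerProductSpace

namespace Literature.Algebra.EuclideanLattices

namespace MicciancioRegev2007

/-! ### Pure real-number estimates -/

/-- **Test (c) threshold of MR07 Thm. 5.23** (p. 30: "`3Nℓ² = 12Ns²β² = 48Nnβ²/(γ²d²) < N/(2πd)²`"),
per sample (divide by `N`): for `β, d > 0`, `n ≥ 1`, `γ = 14π√n β` and `s = 2√n/(γd)`,
`12 s² β² < 1/(2πd)²` — i.e. `48/(196π²d²) < 49/(196π²d²)`. [cite: MicciancioRegev2007, Thm. 5.23 (proof, p. 30, test (c))] -/
theorem twelve_mul_sq_lt {β d : ℝ} {n : ℕ} (hβ : 0 < β) (hd : 0 < d) (hn : 1 ≤ n) :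
    12 * (2 * Real.sqrt n / (14 * π * Real.sqrt n * β * d)) ^ 2 * β ^ 2 < 1 / (2 * π * d) ^ 2 := by
  have hsq : 0 < Real.sqrt n := Real.sqrt_pos.2 (by exact_mod_cast hn)
  have hπ : 0 < π := Real.pi_pos
  have hs : 2 * Real.sqrt n / (14 * π * Real.sqrt n * β * d) = 1 / (7 * π * β * d) := by
    field_simp
    ring
  rw [hs, show (12 : ℝ) * (1 / (7 * π * β * d)) ^ 2 * β ^ 2 = 48 / (196 * (π * d) ^ 2) by
      field_simp; ring,
    show (1 : ℝ) / (2 * π * d) ^ 2 = 49 / (196 * (π * d) ^ 2) by field_simp; ring]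
  exact div_lt_div_of_pos_right (by norm_num) (by positivity)

/-- **The combining error in MR07 Thm. 5.23** (first display of p. 31: "`‖x - Cz‖ ≤ √m n ‖S‖‖z‖/q ≤
8√m n^{1.5} η_ε(B*) β²/q ≤ 2β η_ε(B*)`"): if `σ ≤ 8β√n η` (the bound on `‖S‖` from Cor. 5.13),
`ζ ≤ β` (the SIS′ solution `‖z‖ ≤ β`) and `q ≥ 4√m n^{1.5} β` (the modulus condition of Thm. 5.23,
`n^{1.5} = n√n`), then the Lemma 5.8 bound `n√m σ ζ/q` is at most `2βη`.
[cite: MicciancioRegev2007, Thm. 5.23 (proof, p. 31, first display)] -/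
theorem combine_error_le {β η σ ζ q : ℝ} {n m : ℕ} (hβ : 0 < β) (hη : 0 ≤ η) (hζ0 : 0 ≤ ζ)
    (hq : 0 < q) (hσ : σ ≤ 8 * β * Real.sqrt n * η) (hζ : ζ ≤ β)
    (hmod : 4 * Real.sqrt m * ((n : ℝ) * Real.sqrt n) * β ≤ q) :
    (n : ℝ) * Real.sqrt m * σ * ζ / q ≤ 2 * β * η := by
  rw [div_le_iff₀ hq]
  calc (n : ℝ) * Real.sqrt m * σ * ζ ≤ (n : ℝ) * Real.sqrt m * (8 * β * Real.sqrt n * η) * β := by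
        gcongr
    _ = 2 * β * η * (4 * Real.sqrt m * ((n : ℝ) * Real.sqrt n) * β) := by ring
    _ ≤ 2 * β * η * q := by gcongr

/-- `2βη < sβ` when `η < s/2` (end of the first display of p. 31, using eq. (15)).
[cite: MicciancioRegev2007, Thm. 5.23 (proof, p. 31, first display)] -/
theorem two_mul_mul_lt {β η s : ℝ} (hβ : 0 < β) (hη : η < s / 2) : 2 * β * η < s * β := by
  nlinarith

/-- `(1+ε)/(1-ε) · 2⁻ⁿ ≤ 2⁻ⁿ⁺¹` for `ε = 2⁻ⁿ`, `n ≥ 2` (end of the proof of eq. (16), p. 30; for `n = 1`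
the left side is `3/2 > 1`, so "sufficiently large `n`" starts at `2` here). [cite: MicciancioRegev2007, Thm. 5.23 (proof, p. 30, eq. (16))] -/
theorem one_add_div_one_sub_mul_le {n : ℕ} (hn : 2 ≤ n) :
    (1 + (2⁻¹ : ℝ) ^ n) / (1 - (2⁻¹ : ℝ) ^ n) * (2⁻¹ : ℝ) ^ n ≤ 2 * (2⁻¹ : ℝ) ^ n := by
  have hε : (2⁻¹ : ℝ) ^ n ≤ 4⁻¹ := by
    calc (2⁻¹ : ℝ) ^ n ≤ (2⁻¹ : ℝ) ^ 2 := pow_le_pow_of_le_one (by norm_num) (by norm_num) hn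
      _ = 4⁻¹ := by norm_num
  have hpos : 0 < (2⁻¹ : ℝ) ^ n := by positivity
  have h1 : 0 < 1 - (2⁻¹ : ℝ) ^ n := by linarith
  refine mul_le_mul_of_nonneg_right ?_ hpos.le
  rw [div_le_iff₀ h1]
  linarith

/-! ### Eq. (15): the Gaussian parameter `s` is above twice the smoothing parameter of the dual -/

variable {V : Type*} [NormedAddCommGroup V] [InnerProductSpace ℝ V] [FiniteDimensional ℝ V]
variable (L : Submodule ℤ V) [DiscreteTopology L] [IsZLattice ℝ L]

/-- **MR07 eq. (15)**: for a full-rank lattice `L` of dimension `n ≥ 1` and `0 < γd < λ₁(L)` (the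
first NO condition of `GapCVP′_γ`), `η_{2⁻ⁿ}(L*) ≤ √n/λ₁(L) < √n/(γd)` (Lemma 3.2 for `L*`, `L** = L`).
The product `γ(n) · d` is passed as one real `g`. [cite: MicciancioRegev2007, Thm. 5.23 (proof, p. 29, eq. (15))] -/
theorem smoothingParameter_dual_lt {g : ℝ} (hg : 0 < g) (hgL : g < minNorm L) (hn : 0 < finrank ℝ V) :
    smoothingParameter (dualLattice L) ((2⁻¹ : ℝ) ^ finrank ℝ V) < Real.sqrt (finrank ℝ V) / g := by
  have h := smoothingParameter_two_pow_neg_le_holds (dualLattice L)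
  unfold smoothingParameter_two_pow_neg_le at h
  rw [dualLattice_dualLattice] at h
  refine h.trans_lt (div_lt_div_of_pos_left (Real.sqrt_pos.2 (by exact_mod_cast hn)) hg hgL)

/-- **MR07 eq. (15), halved form**: with `s = 2√n/(γd)`, `η_{2⁻ⁿ}(L*) < s/2` ("hence `s` satisfies
`s > 2η_ε(B*)`", p. 29). [cite: MicciancioRegev2007, Thm. 5.23 (proof, p. 29, eq. (15))] -/
theorem smoothingParameter_dual_lt_half {g : ℝ} (hg : 0 < g) (hgL : g < minNorm L)
    (hn : 0 < finrank ℝ V) :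
    smoothingParameter (dualLattice L) ((2⁻¹ : ℝ) ^ finrank ℝ V) <
      2 * Real.sqrt (finrank ℝ V) / g / 2 := by
  rw [mul_div_assoc, mul_div_cancel_left₀ _ (two_ne_zero' ℝ)]
  exact smoothingParameter_dual_lt L hg hgL hn

/-- **MR07 eq. (15), weak form** `η_{2⁻ⁿ}(L*) ≤ s` for `s = 2√n/(γd)` — the hypothesis under which
Lemma 5.7, Lemmas 4.2–4.4 and Cor. 4.6 are invoked for `D_{L*,s,c}` on pp. 29–31.
[cite: MicciancioRegev2007, Thm. 5.23 (proof, p. 29, eq. (15))] -/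
theorem smoothingParameter_dual_le {g : ℝ} (hg : 0 < g) (hgL : g < minNorm L) (hn : 0 < finrank ℝ V) :
    smoothingParameter (dualLattice L) ((2⁻¹ : ℝ) ^ finrank ℝ V) ≤ 2 * Real.sqrt (finrank ℝ V) / g := by
  have h := smoothingParameter_dual_lt L hg hgL hn
  have hsq : 0 ≤ Real.sqrt (finrank ℝ V) / g := div_nonneg (Real.sqrt_nonneg _) hg.le
  rw [mul_div_assoc]
  linarith

/-! ### Eq. (16): one witness sample has exponentially small expected cosine on a NO instance -/

/-- **From the NO promise to the hypothesis of Cor. 4.6** (p. 30: "By Corollary 4.6, Equation (15), and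
`dist(-zⱼt, L(B)) > γd = 2√n/s`"): if `γd < dist(v, L)` (for `v = k t`, `k` odd, the second NO condition
of `GapCVP′_γ`) and `s = 2√n/(γd)`, `γd > 0`, then every `y ∈ L = (L*)*` has `√n/s ≤ ‖y - v‖`.
[cite: MicciancioRegev2007, Thm. 5.23 (proof, p. 30, eq. (16))] -/
theorem sqrt_div_le_norm_sub_of_far {g : ℝ} (hg : 0 < g) {v : V} (hfar : g < infDist v (L : Set V))
    (y : dualLattice (dualLattice L)) :
    Real.sqrt (finrank ℝ V) / (2 * Real.sqrt (finrank ℝ V) / g) ≤ ‖(y : V) - v‖ := by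
  have hy : (y : V) ∈ (L : Set V) := (dualLattice_dualLattice L).le y.2
  have hdist : infDist v (L : Set V) ≤ ‖(y : V) - v‖ := by
    rw [← dist_eq_norm, dist_comm]
    exact infDist_le_dist_of_mem hy
  refine le_trans ?_ (hfar.le.trans hdist)
  rcases (Real.sqrt_nonneg (finrank ℝ V : ℝ)).eq_or_lt with h0 | hpos
  · rw [← h0]; simp [hg.le]
  · have h1 : Real.sqrt (finrank ℝ V) ≠ 0 := hpos.ne'
    have h2 : g ≠ 0 := hg.ne'
    have : Real.sqrt (finrank ℝ V) / (2 * Real.sqrt (finrank ℝ V) / g) = g / 2 := by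
      field_simp
    rw [this]
    linarith

/-- **MR07 eq. (16), one sample** (p. 30): for a full-rank lattice `L` of dimension `n ≥ 2`, a NO
instance direction `v` (`= -zⱼ t`, `zⱼ` odd) with `γd < dist(v, L)`, `0 < γd < λ₁(L)`, and
`s = 2√n/(γd)`: for every centre `c` and shift `ŵ`,
`Exp_{y ∼ D_{L*,s,c}}[cos(2π⟨y + ŵ, v⟩)] ≤ 2 · 2⁻ⁿ` — Cor. 4.6 for the lattice `L*` (whose dual is `L`)
with `ε = 2⁻ⁿ ≤ 1/4`, eq. (15) for `η_ε(L*) ≤ s`, and `(1+ε)/(1-ε) ≤ 2`.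
[cite: MicciancioRegev2007, Thm. 5.23 (proof, p. 30, eq. (16))] -/
theorem integral_cos_le_of_far [MeasurableSpace V] [BorelSpace V] (hn : 2 ≤ finrank ℝ V) {g : ℝ}
    (hg : 0 < g) (hgL : g < minNorm L) {v : V} (hfar : g < infDist v (L : Set V)) (c ŵ : V) :
    ∫ y, Real.cos (2 * π * ⟪(y : V) + ŵ, v⟫_ℝ)
        ∂(discreteGaussian (dualLattice L) (2 * Real.sqrt (finrank ℝ V) / g) c).toMeasure ≤
      2 * (2⁻¹ : ℝ) ^ finrank ℝ V := by
  have hn0 : 0 < finrank ℝ V := by omega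
  have hsq : 0 < Real.sqrt (finrank ℝ V) := Real.sqrt_pos.2 (by exact_mod_cast hn0)
  have hs : 0 < 2 * Real.sqrt (finrank ℝ V) / g := by positivity
  have hε : 0 < (2⁻¹ : ℝ) ^ finrank ℝ V := by positivity
  have hε1 : (2⁻¹ : ℝ) ^ finrank ℝ V < 1 := pow_lt_one₀ (by norm_num) (by norm_num) hn0.ne'
  exact (integral_discreteGaussian_cos_le (dualLattice L) hε hε1 hs
    (smoothingParameter_dual_le L hg hgL hn0) c ŵ (sqrt_div_le_norm_sub_of_far L hg hfar)).trans
    (one_add_div_one_sub_mul_le hn)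

end MicciancioRegev2007

end Literature.Algebra.EuclideanLattices

end
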